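import Literature.MathematicalPhysics.QuantumFieldTheory.OSSkeletonFunctional
import HarnessLib

/-!
# Seminorms of OS adjoints and tensor products; E0' bounds for the norms of OS vectors

Osterwalder–Schrader II (Comm. Math. Phys. 42 (1975)), Ch. VI.1 ("the only place where we use the
linear growth condition E0'"): norms of vectors of the OS Hilbert space are controlled by E0'
through `‖v(K)‖² = 𝔖_{2n}(ΘK* ⊗ K)`. This file supplies the elementary estimates (all proved):

* `seminorm_osAdjoint_le` — the Schwartz seminorms are invariant under the OS adjoint
  `ΘK*` (conjugation and a linear isometry of the configuration space): `p_{k,l}(ΘK*) ≤ p_{k,l}(K)`;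
  `schwartzNorm_osAdjoint_le`;
* `schwartzNorm_appendTensor_le` — `|F ⊗ G|_M ≤ 2^{M+1} |F|_M |G|_M` (from the tree's
  `SchwartzMap.seminorm_appendTensor_le`);
* `norm_ι_δ_le_of_hasLinearGrowth` — **E0' bound for OS vectors**: under `HasLinearGrowth`
  (`‖𝔖ₙ F‖ ≤ σₙ |F|_{n s}`), `‖v(K)‖ ≤ (|σ_{2n}| 2^{2ns+1})^{1/2} |K|_{2n s}` for every positive-time
  `n`-point `K`.

## References

* K. Osterwalder, R. Schrader, *Axioms for Euclidean Green's functions II*, Comm. Math. Phys.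
  42 (1975) 281–305, Ch. VI.1 p. 297. [OsterwalderSchraderCMP1975]
-/

noncomputable section

open MeasureTheory Set Filter
open _root_.Topology
open scoped InnerProductSpace NNReal ComplexConjugate SchwartzMap

namespace Literature.MathematicalPhysics.QuantumFieldTheory

variable {d : ℕ} [NeZero d]

open Literature.MathematicalPhysics.QuantumLattice (SchwingerFamily IsPositiveTimeMulti schwartzNorm)
open Literature.MathematicalPhysics.QuantumLattice.SchwingerFamily
open Literature.MathematicalPhysics.QuantumLattice.SchwingerFamily.OSSpace

/-! ### The configuration isometry of the OS adjoint -/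

/-- The configuration map of the OS adjoint, `x ↦ (θ x_{rev i})ᵢ`, as a linear isometry of
`(ℝᵈ)ⁿ` (sup norm). [folklore] -/
def adjointConfig (n : ℕ) : (Fin n → EuclideanSpace ℝ (Fin d)) ≃ₗᵢ[ℝ] (Fin n → EuclideanSpace ℝ (Fin d)) where
  toLinearEquiv :=
    (LinearEquiv.funCongrLeft ℝ (EuclideanSpace ℝ (Fin d)) Fin.revPerm).trans
      (LinearEquiv.piCongrRight fun _ => (QuantumLattice.timeReflection d).toLinearEquiv)
  norm_map' x := by
    change ‖fun i => QuantumLattice.timeReflection d (x (Fin.revPerm i))‖ = ‖x‖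
    refine le_antisymm ((pi_norm_le_iff_of_nonneg (norm_nonneg _)).2 fun i => ?_)
      ((pi_norm_le_iff_of_nonneg (norm_nonneg _)).2 fun i => ?_)
    · rw [LinearIsometryEquiv.norm_map]; exact norm_le_pi_norm x _
    · have h := norm_le_pi_norm (fun i => QuantumLattice.timeReflection d (x (Fin.revPerm i))) (Fin.rev i)
      simp only [Fin.revPerm_apply, Fin.rev_rev, LinearIsometryEquiv.norm_map] at h
      exact h

/-- Values of `adjointConfig`. [folklore] -/
@[simp] theorem adjointConfig_apply (n : ℕ) (x : Fin n → EuclideanSpace ℝ (Fin d)) (i : Fin n) :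
    adjointConfig n x i = QuantumLattice.timeReflection d (x (Fin.rev i)) := rfl

/-- The OS adjoint as a composition: `ΘK* = conj ∘ K ∘ adjointConfig`. [folklore] -/
theorem coe_osAdjoint_eq {n : ℕ} (K : 𝓢((Fin n → EuclideanSpace ℝ (Fin d)), ℂ)) :
    (QuantumLattice.osAdjoint K : (Fin n → EuclideanSpace ℝ (Fin d)) → ℂ) =
      Complex.conjLIE ∘ ((K : (Fin n → EuclideanSpace ℝ (Fin d)) → ℂ) ∘ adjointConfig n) := by
  funext x
  simp only [Function.comp_apply, QuantumLattice.osAdjoint_apply]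
  rfl

/-- **The Schwartz seminorms are invariant under the OS adjoint**: `p_{k,l}(ΘK*) ≤ p_{k,l}(K)`. [folklore] -/
theorem seminorm_osAdjoint_le {n : ℕ} (K : 𝓢((Fin n → EuclideanSpace ℝ (Fin d)), ℂ)) (k l : ℕ) :
    SchwartzMap.seminorm ℂ k l (QuantumLattice.osAdjoint K) ≤ SchwartzMap.seminorm ℂ k l K := by
  refine SchwartzMap.seminorm_le_bound ℂ k l _ (apply_nonneg _ _) fun x => ?_
  rw [coe_osAdjoint_eq, Complex.conjLIE.norm_iteratedFDeriv_comp_left,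
    (adjointConfig n).norm_iteratedFDeriv_comp_right, ← (adjointConfig n).norm_map x]
  exact SchwartzMap.le_seminorm ℂ k l K _

/-- `|ΘK*|_M ≤ |K|_M`. [folklore] -/
theorem schwartzNorm_osAdjoint_le {n : ℕ} (K : 𝓢((Fin n → EuclideanSpace ℝ (Fin d)), ℂ)) (M : ℕ) :
    schwartzNorm M (QuantumLattice.osAdjoint K) ≤ schwartzNorm M K := by
  change ((Finset.Iic (M, M)).sup (schwartzSeminormFamily ℂ _ ℂ)) (QuantumLattice.osAdjoint K) ≤ _
  refine Seminorm.finset_sup_apply_le (QuantumLattice.schwartzNorm_nonneg M K) fun q hq => ?_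
  rw [Finset.mem_Iic] at hq
  rw [SchwartzMap.schwartzSeminormFamily_apply]
  exact (seminorm_osAdjoint_le K q.1 q.2).trans (QuantumLattice.seminorm_le_schwartzNorm hq.1 hq.2 K)

/-! ### Tensor products -/

omit [NeZero d] in
/-- The restriction maps `x ↦ x ∘ ι` have operator norm `≤ 1`. [folklore] -/
theorem norm_restrictCLM_le {α β : Type*} [Fintype α] [Fintype β] (ι : α → β) :
    ‖SchwartzMap.restrictCLM (E := EuclideanSpace ℝ (Fin d)) ι‖ ≤ 1 := by
  refine ContinuousLinearMap.opNorm_le_bound _ zero_le_one fun x => ?_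
  rw [one_mul, SchwartzMap.restrictCLM_apply]
  exact (pi_norm_le_iff_of_nonneg (norm_nonneg _)).2 fun a => norm_le_pi_norm x (ι a)

omit [NeZero d] in
/-- Real and complex Schwartz seminorms agree. [folklore] -/
theorem seminorm_real_eq {X : Type*} [NormedAddCommGroup X] [NormedSpace ℝ X] (k l : ℕ) (F : 𝓢(X, ℂ)) :
    SchwartzMap.seminorm ℝ k l F = SchwartzMap.seminorm ℂ k l F := rfl

omit [NeZero d] in
/-- **Schwartz norms of tensor products**: `|F ⊗ G|_M ≤ 2^{M+1} |F|_M |G|_M`. [folklore] -/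
theorem schwartzNorm_appendTensor_le {n m : ℕ} (F : 𝓢((Fin n → EuclideanSpace ℝ (Fin d)), ℂ))
    (G : 𝓢((Fin m → EuclideanSpace ℝ (Fin d)), ℂ)) (M : ℕ) :
    schwartzNorm M (F.appendTensor G) ≤ 2 ^ (M + 1) * schwartzNorm M F * schwartzNorm M G := by
  have hF0 := QuantumLattice.schwartzNorm_nonneg M F
  have hG0 := QuantumLattice.schwartzNorm_nonneg M G
  change ((Finset.Iic (M, M)).sup (schwartzSeminormFamily ℂ _ ℂ)) (F.appendTensor G) ≤ _
  refine Seminorm.finset_sup_apply_le (by positivity) fun q hq => ?_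
  rw [Finset.mem_Iic] at hq
  rw [SchwartzMap.schwartzSeminormFamily_apply]
  refine (SchwartzMap.seminorm_appendTensor_le F G q.1 q.2).trans ?_
  unfold SchwartzMap.mulCompBound
  rw [abs_one, one_pow, one_mul]
  -- each term is at most `choose · 2 |F|_M |G|_M`
  have hterm : ∀ i ∈ Finset.range (q.2 + 1), (q.2.choose i : ℝ) *
      (‖SchwartzMap.restrictCLM (E := EuclideanSpace ℝ (Fin d)) (Fin.castAdd (n := n) m)‖ ^ i *
        ‖SchwartzMap.restrictCLM (E := EuclideanSpace ℝ (Fin d)) (Fin.natAdd n (m := m))‖ ^ (q.2 - i)) *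
      (SchwartzMap.seminorm ℝ q.1 i F * SchwartzMap.seminorm ℝ 0 (q.2 - i) G +
        SchwartzMap.seminorm ℝ 0 i F * SchwartzMap.seminorm ℝ q.1 (q.2 - i) G) ≤
      (q.2.choose i : ℝ) * (2 * (QuantumLattice.schwartzNorm M F * QuantumLattice.schwartzNorm M G)) := by
    intro i hi
    rw [Finset.mem_range] at hi
    have hq2 : q.2 ≤ M := hq.2
    have hπ : ‖SchwartzMap.restrictCLM (E := EuclideanSpace ℝ (Fin d)) (Fin.castAdd (n := n) m)‖ ^ i *
        ‖SchwartzMap.restrictCLM (E := EuclideanSpace ℝ (Fin d)) (Fin.natAdd n (m := m))‖ ^ (q.2 - i) ≤ 1 :=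
      mul_le_one₀ (pow_le_one₀ (norm_nonneg _) (norm_restrictCLM_le _)) (by positivity)
        (pow_le_one₀ (norm_nonneg _) (norm_restrictCLM_le _))
    have h1 : SchwartzMap.seminorm ℝ q.1 i F ≤ QuantumLattice.schwartzNorm M F := by
      rw [seminorm_real_eq]; exact QuantumLattice.seminorm_le_schwartzNorm hq.1 (by omega) F
    have h2 : SchwartzMap.seminorm ℝ 0 (q.2 - i) G ≤ QuantumLattice.schwartzNorm M G := by
      rw [seminorm_real_eq]; exact QuantumLattice.seminorm_le_schwartzNorm (Nat.zero_le _) (by omega) G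
    have h3 : SchwartzMap.seminorm ℝ 0 i F ≤ QuantumLattice.schwartzNorm M F := by
      rw [seminorm_real_eq]; exact QuantumLattice.seminorm_le_schwartzNorm (Nat.zero_le _) (by omega) F
    have h4 : SchwartzMap.seminorm ℝ q.1 (q.2 - i) G ≤ QuantumLattice.schwartzNorm M G := by
      rw [seminorm_real_eq]; exact QuantumLattice.seminorm_le_schwartzNorm hq.1 (by omega) G
    have hsum : SchwartzMap.seminorm ℝ q.1 i F * SchwartzMap.seminorm ℝ 0 (q.2 - i) G +
        SchwartzMap.seminorm ℝ 0 i F * SchwartzMap.seminorm ℝ q.1 (q.2 - i) G ≤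
        2 * (QuantumLattice.schwartzNorm M F * QuantumLattice.schwartzNorm M G) := by
      have := mul_le_mul h1 h2 (apply_nonneg _ _) hF0
      have := mul_le_mul h3 h4 (apply_nonneg _ _) hF0
      linarith
    calc (q.2.choose i : ℝ) * (‖SchwartzMap.restrictCLM (E := EuclideanSpace ℝ (Fin d)) (Fin.castAdd (n := n) m)‖ ^ i *
          ‖SchwartzMap.restrictCLM (E := EuclideanSpace ℝ (Fin d)) (Fin.natAdd n (m := m))‖ ^ (q.2 - i)) *
          (SchwartzMap.seminorm ℝ q.1 i F * SchwartzMap.seminorm ℝ 0 (q.2 - i) G +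
            SchwartzMap.seminorm ℝ 0 i F * SchwartzMap.seminorm ℝ q.1 (q.2 - i) G)
        ≤ (q.2.choose i : ℝ) * 1 * (2 * (QuantumLattice.schwartzNorm M F * QuantumLattice.schwartzNorm M G)) := by
          gcongr
      _ = _ := by ring
  refine (Finset.sum_le_sum hterm).trans ?_
  rw [← Finset.sum_mul]
  have hchoose : ∑ i ∈ Finset.range (q.2 + 1), (q.2.choose i : ℝ) = 2 ^ q.2 := by
    have h := Nat.sum_range_choose q.2
    exact_mod_cast h
  rw [hchoose]
  have h2 : (2 : ℝ) ^ q.2 ≤ 2 ^ M := pow_le_pow_right₀ (by norm_num) hq.2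
  calc (2 : ℝ) ^ q.2 * (2 * (QuantumLattice.schwartzNorm M F * QuantumLattice.schwartzNorm M G))
      ≤ 2 ^ M * (2 * (QuantumLattice.schwartzNorm M F * QuantumLattice.schwartzNorm M G)) := by gcongr
    _ = 2 ^ (M + 1) * QuantumLattice.schwartzNorm M F * QuantumLattice.schwartzNorm M G := by rw [pow_succ]; ring

/-! ### E0' bounds for the norms of OS vectors -/

/-- **E0' bound for OS vectors**: if `‖𝔖ₙ F‖ ≤ σₙ |F|_{n s}` for all `n, F` (`HasLinearGrowth`),
then for every positive-time `n`-point `K`,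
`‖v(K)‖ ≤ (|σ_{2n}| 2^{2ns+1})^{1/2} |K|_{2ns}` (`‖v(K)‖² = 𝔖_{2n}(ΘK* ⊗ K)`). [cite: OsterwalderSchraderCMP1975, Ch. VI.1 p. 297] -/
theorem norm_ι_δ_le_of_growth (𝔖 : SchwingerFamily (EuclideanSpace ℝ (Fin d))) (hE2 : 𝔖.IsOSReflectionPositive)
    {s : ℕ} {σ : ℕ → ℝ} (hσ : ∀ (n : ℕ) (F : 𝓢((Fin n → EuclideanSpace ℝ (Fin d)), ℂ)), ‖𝔖 n F‖ ≤ σ n * schwartzNorm (n * s) F)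
    {n : ℕ} (K : 𝓢((Fin n → EuclideanSpace ℝ (Fin d)), ℂ)) (hK : IsPositiveTimeMulti K) :
    ‖ι 𝔖 hE2 (δ 𝔖 hE2 (mkGen K hK))‖ ≤
      Real.sqrt (|σ (n + n)| * 2 ^ ((n + n) * s + 1)) * schwartzNorm ((n + n) * s) K := by
  set M : ℕ := (n + n) * s with hM
  have hK0 := QuantumLattice.schwartzNorm_nonneg M K
  have hsq : ‖ι 𝔖 hE2 (δ 𝔖 hE2 (mkGen K hK))‖ ^ 2 ≤ |σ (n + n)| * 2 ^ (M + 1) * schwartzNorm M K ^ 2 := by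
    rw [LinearIsometry.norm_map, norm_δ_sq]
    refine (RCLike.re_le_norm _).trans ?_
    rw [genPairing_eq]
    change ‖𝔖 (n + n) ((QuantumLattice.osAdjoint K).appendTensor K)‖ ≤ _
    refine (hσ _ _).trans ?_
    have h1 := schwartzNorm_appendTensor_le (QuantumLattice.osAdjoint K) K M
    have h2 := schwartzNorm_osAdjoint_le K M
    calc σ (n + n) * schwartzNorm M ((QuantumLattice.osAdjoint K).appendTensor K)
        ≤ |σ (n + n)| * schwartzNorm M ((QuantumLattice.osAdjoint K).appendTensor K) :=
          mul_le_mul_of_nonneg_right (le_abs_self _) (QuantumLattice.schwartzNorm_nonneg _ _)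
      _ ≤ |σ (n + n)| * (2 ^ (M + 1) * schwartzNorm M (QuantumLattice.osAdjoint K) * schwartzNorm M K) := by
          gcongr
      _ ≤ |σ (n + n)| * (2 ^ (M + 1) * schwartzNorm M K * schwartzNorm M K) := by
          gcongr
      _ = |σ (n + n)| * 2 ^ (M + 1) * schwartzNorm M K ^ 2 := by ring
  have hrhs : |σ (n + n)| * 2 ^ (M + 1) * schwartzNorm M K ^ 2 =
      (Real.sqrt (|σ (n + n)| * 2 ^ (M + 1)) * schwartzNorm M K) ^ 2 := by
    rw [mul_pow, Real.sq_sqrt (by positivity)]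
  rw [hrhs] at hsq
  exact le_of_pow_le_pow_left₀ two_ne_zero (by positivity) hsq

/-- **E0' bound for OS vectors** from `HasLinearGrowth`: there are `s` and constants `Cₙ` with
`‖v(K)‖ ≤ Cₙ |K|_{2ns}` for all positive-time `n`-point `K`. [cite: OsterwalderSchraderCMP1975, Ch. VI.1 p. 297] -/
theorem exists_norm_ι_δ_le_of_hasLinearGrowth (𝔖 : SchwingerFamily (EuclideanSpace ℝ (Fin d)))
    (hE2 : 𝔖.IsOSReflectionPositive) (hE0 : 𝔖.HasLinearGrowth) :
    ∃ (s : ℕ) (C : ℕ → ℝ), (∀ n, 0 ≤ C n) ∧ ∀ (n : ℕ) (K : 𝓢((Fin n → EuclideanSpace ℝ (Fin d)), ℂ))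
      (hK : IsPositiveTimeMulti K), ‖ι 𝔖 hE2 (δ 𝔖 hE2 (mkGen K hK))‖ ≤ C n * schwartzNorm ((n + n) * s) K := by
  obtain ⟨s, σ, α, β, -, hσ⟩ := hE0
  exact ⟨s, fun n => Real.sqrt (|σ (n + n)| * 2 ^ ((n + n) * s + 1)), fun n => Real.sqrt_nonneg _,
    fun n K hK => norm_ι_δ_le_of_growth 𝔖 hE2 hσ K hK⟩

end Literature.MathematicalPhysics.QuantumFieldTheory
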